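import Summits.BirchSwinnertonDyer.Rank1Residual.X11b.WeilTransport
import Summits.BirchSwinnertonDyer.Rank1Residual.X11b.AnticyclotomicSelmerStructure
import Summits.BirchSwinnertonDyer.Rank1Residual.X11b.PrimaryInclusionLevels
import Summits.BirchSwinnertonDyer.Rank1Residual.X11b.AnticyclotomicLevelStructure
import Summits.BirchSwinnertonDyer.Rank1Residual.X11b.PerfectPairingAnnihilators
import Literature.NumberTheory.GaloisCohomology.PoitouTateSha
import Literature.NumberTheory.GaloisRepresentations.LocalGlobalCohomologyDualityProofs
import Literature.NumberTheory.EllipticCurves.WeilPairingProofs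
import HarnessLib

/-!
# X11b, route R1 — `#Ш²(K, E[p^k]) ≤ #Sel_𝔭(K, E[p^∞])` uniformly in `k` (Poitou–Tate for `Ш`,
# Weil self-duality, and the embedding `Ш¹(K, E[p^k]) ↪ Sel_𝔭(K, E[p^∞])`), towards (L10)

HONEST FRAMING (cell `b2b-bsdres`, run/shared/lean/b2b/bsd-rank1-residual/, verbatim in every
file): the goal of the cell is to DELETE the COMBINATION-SHAPED residual classes of the
Birch–Swinnerton-Dyer formula for ALL analytic-rank `≤ 1` elliptic curves over `ℚ` — "full BSD
formula for every rank `≤ 1` curve in class `C`" assembled STRICTLY from published theorems — so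
that the rank-`≤ 1` remainder becomes exactly the CONSTRUCTION-SHAPED classes, which are TYPED
(missing-input `Prop`s), NOT attempted. This is not "finishing BSD". Sub-cell
`b2b-bsdres-multr1-p1` (X11b, route R1 = Castella 2018 Thm. A re-proved along the author's
erratum); a RESEARCH ROUTE; no claim beyond the stated class; X11b stays CONSTRUCTION-SHAPED;
nothing here changes a label; no named fact is minted (theorems only; no `sorry`); CONDITIONAL on
the cited `poitouTate_sha_tateDual K` (Harari Thm. 17.13 (b) / Milne I 4.10 (a)).

## What this file does

JSW17 Lemma 3.3.3: "`Ш²_S(K, W)` … By Poitou–Tate duality [milne:duality], this group is dual to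
`Ш¹_S(K, T)` … and the latter is trivial. Indeed, (irredK) implies that `Ш¹_S(K, T)` is torsion-free
while (crk1) and (surjp) imply that `Ш¹_S(K, T)` is torsion". The tree's Poitou–Tate fact for `Ш`
(`poitouTate_sha_tateDual`, all places) is EXISTENTIAL (no naturality in the module), so the limit
`T = lim← E[p^k]` cannot be taken through it. Route R1's substitute (gen 16): a bound
**`#Ш²(K, E[p^k]) ≤ B` UNIFORM in `k`**, where `B = #Sel_𝔭(K, E[p^∞])` is the finite order of
Castella's Selmer group over `K` — finiteness being clause one of the typed atom (P6)
`BaseSelmerCountAt` of the statement of record (so no new input):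

* `map_mem_sha` — an intertwining map carries `Ш¹` into `Ш¹` (naturality of localisation);
* `natCard_shaTwo_eq_natCard_sha_tateDual` — `#Ш²(K, M) = #Ш¹(K, M^D)` from the cited fact;
* `natCard_sha_tateDual_le` — `#Ш¹(K, E[n]^D) ≤ #Ш¹(K, E[n])` (Weil transport `w⁻¹`, injective on `H¹`);
* `natCard_sha_torsion_le_selmerAcBase` — **`#Ш¹(K, E[p^k]) ≤ #Sel_𝔭(K, E[p^∞])`**: `H¹(ι_k)` is
  injective when `E[p^∞]^{Γ_K} = 0` and carries `Ш¹` into `Ш¹(K, E[p^∞])`, which satisfies EVERY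
  Selmer structure, in particular Castella's (`topEquivH1_mem_selmerAcBase_iff`);
* **`natCard_shaTwo_torsion_le_selmerAcBase`**: `#Ш²(K, E[p^k]) ≤ #Sel_𝔭(K, E[p^∞])`, `k ≥ 1`.

References: [JetchevSkinnerWan2017] Lemma 3.3.3 (arXiv:1512.06894 p. 12); [Harari2020] Thm. 17.13 (b);
[MilneADT2006] I Thm. 4.10 (a), Cor. 2.3; [Castella2018] Def. 2.2 (arXiv:1704.06608 p. 5).
-/

noncomputable section

open scoped Classical

open CategoryTheory Field NumberField IsDedekindDomain
open Literature.NumberTheory.EllipticCurves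
open Literature.NumberTheory.GaloisRepresentations
open Literature.NumberTheory.GaloisRepresentations.DiscreteGaloisModule
open Literature.NumberTheory.GaloisCohomology
open scoped ContRepresentation


namespace Summit.BirchSwinnertonDyer.Rank1Residual.X11b.ShaBound

/-! ## §1. Generic: intertwining maps carry `Ш¹` into `Ш¹`; `#Ш² = #Ш¹` of the dual -/

section Generic

variable {K : Type} [Field K] [NumberField K]
  {M M' : Type} [AddCommGroup M] [TopologicalSpace M] [DiscreteTopology M]
  [AddCommGroup M'] [TopologicalSpace M'] [DiscreteTopology M']
  {ρ : DiscreteGaloisModule K M} {ρ' : DiscreteGaloisModule K M'}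

/-- **`H¹(f)` carries `Ш¹(K, M)` into `Ш¹(K, M')`** (naturality of localisation at every place,
`localization_map_one`). [folklore] -/
theorem map_mem_sha (f : ρ.toContRepresentation →ⁱL ρ'.toContRepresentation)
    {x : galoisCohomology ρ 1} (hx : x ∈ ρ.sha) : galoisCohomology.map f 1 x ∈ ρ'.sha := by
  rw [mem_sha_iff] at hx ⊢
  intro v
  rw [Levels.localization_map_one, hx v]
  exact map_zero _

/-- **`#Ш²(K, M) = #Ш¹(K, M^D)`** for a finite `n`-torsion module, `n ≥ 1`, from the cited
Poitou–Tate duality of `Ш` (existential perfect pairing into `ℤ/n`; `#Hom(B, ℤ/n) = #B` for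
`n`-torsion `B`). [cite: Harari2020, Thm. 17.13 (b)] [cite: MilneADT2006, Ch. I, Thm. 4.10 (a)] -/
theorem natCard_shaTwo_eq_natCard_sha_tateDual (hPT : poitouTate_sha_tateDual K) (n : ℕ) [NeZero n]
    [Finite M] (ρ : DiscreteGaloisModule K M) (hM : ∀ m : M, n • m = 0) :
    Finite (shaTwo ρ) ∧ Finite (sha (ρ.tateDual n)) ∧
      Nat.card (shaTwo ρ) = Nat.card (sha (ρ.tateDual n)) := by
  obtain ⟨hfin1, hfin2, b, hb, -⟩ := hPT n M ρ hM
  refine ⟨hfin2, hfin1, ?_⟩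
  haveI := hfin1
  refine FiniteDuality.natCard_eq_of_bijective (n := n) (fun y ↦ Subtype.ext ?_) b hb
  exact galoisCohomology.nsmul_eq_zero_of_forall _ (fun f ↦ TateDual.nsmul_eq_zero f)
    (y : galoisCohomology (ρ.tateDual n) 1)

end Generic

/-! ## §2. `#Ш¹(K, E[n]^D) ≤ #Ш¹(K, E[n])` by Weil transport -/

section Weil

variable {K : Type} [Field K] [NumberField K] (W : WeierstrassCurve K) [W.IsElliptic]
  (n : ℕ) [NeZero n]

attribute [local instance] finite_geomTorsion_of_neZero

/-- **`#Ш¹(K, E[n]^D) ≤ #Ш¹(K, E[n])`** (`n ≥ 2`): the inverse Weil transport `H¹(w⁻¹)` is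
injective on `H¹(K, E[n]^D)` (`H¹(w) ∘ H¹(w⁻¹) = id`) and carries `Ш¹` into `Ш¹`.
[cite: MilneADT2006, Ch. I §6, proof of Prop. 6.9] [cite: SilvermanAEC2009, Prop. III.8.1] -/
theorem natCard_sha_tateDual_le (h2 : 2 ≤ n) [Finite (sha (W.torsionGaloisModule n))] :
    Nat.card (sha ((W.torsionGaloisModule n).tateDual n)) ≤ Nat.card (sha (W.torsionGaloisModule n)) := by
  haveI : PerfectField K := PerfectField.ofCharZero
  obtain ⟨e, hμ, hadd₁, hadd₂, -, hnondeg, hgal⟩ :=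
    WeierstrassCurve.exists_weilPairing_holds W n h2 (by exact_mod_cast NeZero.ne n)
  let f : sha ((W.torsionGaloisModule n).tateDual n) → sha (W.torsionGaloisModule n) :=
    fun y ↦ ⟨galoisCohomology.map (LocBridge.weilDualInv W n e hμ hadd₁ hadd₂ hgal hnondeg) 1 y,
      map_mem_sha _ y.2⟩
  refine Nat.card_le_card_of_injective f fun y₁ y₂ h ↦ Subtype.ext ?_
  have h' := congrArg (fun z : sha (W.torsionGaloisModule n) ↦
    galoisCohomology.map (weilDualIntertwining W n e hμ hadd₁ hadd₂ hgal) 1 (z : _)) h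
  have e₁ := LocBridge.map_weilDual_map_weilDualInv W n e hμ hadd₁ hadd₂ hgal hnondeg
    (y₁ : galoisCohomology ((W.torsionGaloisModule n).tateDual n) 1)
  have e₂ := LocBridge.map_weilDual_map_weilDualInv W n e hμ hadd₁ hadd₂ hgal hnondeg
    (y₂ : galoisCohomology ((W.torsionGaloisModule n).tateDual n) 1)
  change galoisCohomology.map (weilDualIntertwining W n e hμ hadd₁ hadd₂ hgal) 1
      (galoisCohomology.map (LocBridge.weilDualInv W n e hμ hadd₁ hadd₂ hgal hnondeg) 1 y₁) =
    galoisCohomology.map (weilDualIntertwining W n e hμ hadd₁ hadd₂ hgal) 1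
      (galoisCohomology.map (LocBridge.weilDualInv W n e hμ hadd₁ hadd₂ hgal hnondeg) 1 y₂) at h'
  rwa [e₁, e₂] at h'

end Weil

/-! ## §3. `Ш¹(K, E[p^k]) ↪ Sel_𝔭(K, E[p^∞])` and the uniform bound on `#Ш²(K, E[p^k])` -/

section Level

variable {K : Type} [Field K] [NumberField K] (W : WeierstrassCurve K)
  (p : ℕ) [Fact p.Prime] (k : ℕ) (𝔭 : HeightOneSpectrum (𝓞 K))

attribute [local instance] finite_geomTorsion_of_neZero

/-- **`Ш¹(K, E[p^k]) ↪ Sel_𝔭^Σ(K, E[p^∞])`, hence `#Ш¹(K, E[p^k]) ≤ #Sel_𝔭^Σ(K, E[p^∞])`** whenever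
the latter is finite and `E[p^∞]^{Γ_K} = 0`: `H¹(ι_k) : H¹(K, E[p^k]) → H¹(K, E[p^∞])` is then
injective (`map_primaryInclusion_injective`), carries `Ш¹` into `Ш¹(K, E[p^∞])` (`map_mem_sha`), and
`Ш¹` lies in the Selmer group of EVERY Selmer structure (`sha_le_selmerGroup`), in particular in
Castella's (`acStructure`; `topEquivH1_mem_selmerAcBase_iff`).
[cite: Castella2018, Def. 2.2 (arXiv:1704.06608 p. 5)] [cite: GreenbergLNM1716, §2 p. 63] -/
theorem natCard_sha_torsion_le_selmerAcBase (S : Set (HeightOneSpectrum (𝓞 K)))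
    [Finite (AcSelmer.selmerAcBase W p 𝔭 S)]
    (hΓ : ∀ Q : W.geomPrimaryTorsion p,
      (∀ σ : absoluteGaloisGroup K, LocBridge.primaryGaloisModule W p σ Q = Q) → Q = 0) :
    Finite (sha (W.torsionGaloisModule ((p ^ k : ℕ) : ℤ))) ∧
      Nat.card (sha (W.torsionGaloisModule ((p ^ k : ℕ) : ℤ))) ≤
        Nat.card (AcSelmer.selmerAcBase W p 𝔭 S) := by
  let f : sha (W.torsionGaloisModule ((p ^ k : ℕ) : ℤ)) → AcSelmer.selmerAcBase W p 𝔭 S :=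
    fun x ↦ ⟨LocBridge.topEquivH1 (LocBridge.isOpen_stabilizer_geomPrimaryTorsion W p)
      (galoisCohomology.map (Levels.primaryInclusion W p k) 1 x), by
        rw [AcSelmer.topEquivH1_mem_selmerAcBase_iff]
        exact sha_le_selmerGroup _ _ (map_mem_sha _ x.2)⟩
  have hf : Function.Injective f := fun x₁ x₂ h ↦ by
    apply Subtype.ext
    apply Levels.map_primaryInclusion_injective W p k hΓ
    exact (LocBridge.topEquivH1 (LocBridge.isOpen_stabilizer_geomPrimaryTorsion W p)).injective
      (congrArg Subtype.val h)
  exact ⟨Finite.of_injective f hf, Nat.card_le_card_of_injective f hf⟩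

/-- **`#Ш²(K, E[p^k]) ≤ #Sel_𝔭^Σ(K, E[p^∞])` for every `k ≥ 1`**, granted the cited Poitou–Tate
duality for `Ш` (`poitouTate_sha_tateDual K`), the finiteness of Castella's Selmer group over `K`
(clause one of atom (P6) `BaseSelmerCountAt`) and `E[p^∞]^{Γ_K} = 0` (from hypothesis `irr_K`):
`#Ш²(K, E[p^k]) = #Ш¹(K, E[p^k]^D) ≤ #Ш¹(K, E[p^k]) ≤ #Sel_𝔭^Σ(K, E[p^∞])` — the substitute, at
finite level and uniformly in `k`, for "`Ш²_S(K, W)` is dual to `Ш¹_S(K, T) = 0`" of JSW17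
Lemma 3.3.3. [cite: JetchevSkinnerWan2017, Lemma 3.3.3 (arXiv:1512.06894 p. 12)]
[cite: Harari2020, Thm. 17.13 (b)] -/
theorem natCard_shaTwo_torsion_le_selmerAcBase [W.IsElliptic] (hPT : poitouTate_sha_tateDual K) (hk : k ≠ 0)
    (S : Set (HeightOneSpectrum (𝓞 K))) [Finite (AcSelmer.selmerAcBase W p 𝔭 S)]
    (hΓ : ∀ Q : W.geomPrimaryTorsion p,
      (∀ σ : absoluteGaloisGroup K, LocBridge.primaryGaloisModule W p σ Q = Q) → Q = 0) :
    Finite (shaTwo (W.torsionGaloisModule ((p ^ k : ℕ) : ℤ))) ∧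
      Nat.card (shaTwo (W.torsionGaloisModule ((p ^ k : ℕ) : ℤ))) ≤
        Nat.card (AcSelmer.selmerAcBase W p 𝔭 S) := by
  have hprime : p.Prime := Fact.out
  haveI : NeZero (p ^ k) := ⟨pow_ne_zero k hprime.ne_zero⟩
  have h2 : 2 ≤ p ^ k :=
    le_trans hprime.two_le (by simpa using Nat.pow_le_pow_right hprime.pos (Nat.one_le_iff_ne_zero.2 hk))
  obtain ⟨hfin2, -, hcard⟩ := natCard_shaTwo_eq_natCard_sha_tateDual hPT (p ^ k)
    (W.torsionGaloisModule ((p ^ k : ℕ) : ℤ)) (fun T ↦ AddSubgroup.torsionBy.nsmul T)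
  obtain ⟨hfin1, hle⟩ := natCard_sha_torsion_le_selmerAcBase W p k 𝔭 S hΓ
  haveI := hfin1
  exact ⟨hfin2, hcard ▸ (natCard_sha_tateDual_le W (p ^ k) h2).trans hle⟩

end Level

end Summit.BirchSwinnertonDyer.Rank1Residual.X11b.ShaBound

end
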